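import Summits.QuantumFields.YangMills.Theorems.UnitScaleTiltProp7LODTargetExists
import Summits.QuantumFields.YangMills.Theorems.UnitScaleTiltProp7GaugeFixedRowDoorOfLODTarget
import Summits.QuantumFields.YangMills.Theorems.UnitScaleTiltProp7LaplaceAFlatCoercive
import Summits.QuantumFields.YangMills.Theorems.UnitScaleTiltProp7CoerciveOfGaugeFixedLift
import HarnessLib

/-!
# Route `UnitScaleTilt`, crux K1 «MinimiserStabilityRegPr» (stmt-QuantumFields-19200), EX one-form storey — **THE (γ) LETTER HOLDS: `Δ_a(U₀)` IS COERCIVE,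
# K-UNIFORMLY, AT EVERY LIFTED PRINTED-REGULAR BACKGROUND** ([Balaban1985BackgroundPropagators] Thm 3.11 «`Δ_a`, `G` are positive definite», quantitative form,
# as a COMPOSITION of the landed LOD ∕ IMS ∕ Combes–Thomas line)

Cell `ym3-torus` (HUMAN RULING D-0037; rung R3 = SU(2) YM₃ on T³ — NOT d = 4, NOT infinite volume, NOT a mass gap, NOT Clay).  Fleet lead ∕ chair seat `ym-ust-19200-p1`
(gen 27), CHAIR LOCATE №18; the same knit was located CONCURRENTLY and independently by width seat `ym3-torus-px19` g13 (LOCATE #42 §3, SIGNATURE 06e3f1dd, 2026-08-30) — credit shared.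
THEOREMS ONLY (0 `def`, 0 `sorry`); `--supports stmt-QuantumFields-19200 --as helper`; count-neutral.
THE LETTER.  The one-form storey (O2 ✓`Prop7OneFormKatoBootstrap` → A1 ✓`Prop7OneFormGarding` → A3∕A4∕A4b → O4-E2E ✓`Prop7OneFormPointwiseDecayE2E.pointwiseDecay_oneForm_DeltaEtaSlot`,
(K2) ✓`Prop7OneFormGreenKernelRow.kernelRow_GT_DeltaEtaSlot`) displays ONE coercivity letter
`hco : ∀ v, γ·‖v‖² ≤ re⟪v, laplaceA F n K h c₀ cB a Δx U₀ v⟫` for the member's `Δ_a(U₀) = Δx(U₀) + D_{U₀}R_S(U₀)D*_{U₀} + Q_k†aQ_k` ((3.26)) at the raw slot `Δx := DeltaEtaSlot`.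
CHAIR LOCATE №15 (★p1 g26) called it «OPEN, crux-sized».  IT IS NOT: the S45 event already paid for it.  The LOD line's `∃`-packaged curved target
✓`Prop7LODTargetExists.hT_exists` gives, at every member `i = (F, n < K)` of the display's index, every `U₀ ∈ RegPr (αLOD L)` and every top nested mean `Q″` of record,
`γLOD L·‖A‖² ≤ re⟪A, Δ^η(U₀)A⟫ + ‖projR (Δ^η_{U₀}) Q″ (D*_{U₀}A)‖² + aLOD·‖Q_k(U₀)A‖²` for ALL `A` (no slice antecedent); under the Lift antecedent of record
`R_S(U₀) = projR (Δ^η_{U₀}) Q″` (✓`Prop7LiftOfRSEqPrintProjector.RS_eq_projR_iff_lift` with ✓`Prop7NSIntertwinerOfRecord.exists_intertwiner_of_regPr`), and the three-term form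
✓`Prop7LaplaceAFlatCoercive.re_inner_laplaceA` `re⟪v, Δ_a v⟫ = re⟪v, Δx v⟫ + ‖R_S D* v‖² + a‖Q_k v‖²` (any background, any slot) turns the target into `hco` with the LOD line's OWN
constant `γLOD L` — no passage through the slice row ∕ the gauge decomposition (3.118) (★p1 g22 ✓`coercive_laplaceA_*_of_gaugeFixed_of_lift`, constant `min γ ½ ∕ 2`), no `1029ε₀` loss.

WHAT IS PROVED (ns `…Theorems.Prop7OneFormCoerciveHolds`; member `F n K`, `h : n ≤ K`, weights `c₀ cB > 0`).
* §1 ★★★ `coercive_laplaceA_of_curvedTarget_of_lift` — member door: `RegPr F n K ε₀ U₀`, `10¹²L³ε₀ ≤ 1`, the curved target `hT` for every `Q″` of record at coupling `a`, `Lift(U₀)`,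
  ANY slot with `Δx U₀ v = Δ^η(U₀) v`, any coupling `a′ ≥ a` ⟹ `∀ v, γ‖v‖² ≤ re⟪v, Δ_a′(Δx)(U₀) v⟫`; ★★ `…_DeltaEtaSlot_…` (the E2E slot), ★★ `…_add_of_curvedTarget_of_lift`
  (slot `Δ^η + T` with `re⟪v, T v⟫ ≥ −τ‖v‖²`: constant `γ − τ`).
* §2 ★★ `posOnto_of_coercive` (`0 < γ` + `n < K` + `13·10¹⁴L³ε₀ ≤ 1` ⟹ the class `PosOnto`: `Δ_a` positive definite, `Q_k` onto by ✓`surjective_Qk_of_regPr`) and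
  ★★★ `norm_GT_le_of_coercive` — the `L²` HALF OF THE EX ROW `norm_G`: `‖G(U₀) f‖ ≤ γ⁻¹·‖f‖` (Lax–Milgram by hand: `γ‖Gf‖² ≤ re⟪Gf, f⟫ ≤ ‖Gf‖‖f‖`, ✓`laplaceA_GT`).
* §3 ★★★ `coercive_laplaceA_idx_of_curvedTarget_of_le_coupling` — the door at the display's index `T3Thm1Carrier.Idx L` (letters `αcap c₀ cB aLOD ≤ a γ`, the `hT` binder of
  ✓`gaugeFixedRow_idx_of_curvedTarget_of_le_coupling` VERBATIM) ⟹ `hco` at `DeltaEtaSlot`, Lift-threaded like every EX row.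
* §4 ★★★★ `hco_DeltaEtaSlot_exists` — THE (γ) LETTER `∃`-PACKAGED (the `hT_exists` export shape): for weights `c₀ cB : ℕ → ℝ` and `a₀ > 0` there are `αco γco : ℕ → ℝ` with
  `0 < αco L`, `10¹²L³·αco L ≤ 1`, `13·10¹⁴L³·αco L ≤ 1`, `0 < γco L` (`1 < L`) such that for every member `i`, every `RegPr ρ U₀` with `ρ ≤ αco L`, `Lift L i U₀`, and every
  coupling `a ≥ a₀·(c₀ L∕cB L)·(L^{K−n})³`: `∀ v, γco L·‖v‖² ≤ re⟪v, laplaceA … a (DeltaEtaSlot …) U₀ v⟫`; ★★★ `normG_DeltaEtaSlot_exists` — same letters, `n < K` (every `Idx`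
  member): `‖GT … a (DeltaEtaSlot …) U₀ f‖ ≤ (γco L)⁻¹·‖f‖` and `PosOnto`.
* §5 ★★ `coercive_laplaceA_DeltaPiSlotP_of_curvedTarget_of_lift` ∕ ★★★ `hco_DeltaPiSlotP_exists` — the Π-slot `Δx := DeltaPiSlotP` (the slot of the EX rows `norm_Hπ`, `h133`,
  `h88`, `h137kπ`): `hco` with constant `min γ ½ ∕ 2` through the slice row (door ✓`gaugeFixedRow_of_curvedTarget`) and ★p1 g22 ✓`coercive_laplaceA_piSlot_of_gaugeFixed_of_lift`.
EFFECT: the displayed letter (γ) of 6 landed one-form files (A1, A3, A4, A4b, O4-E2E, K2) is inhabited by name; the EX row `norm_G`'s `L²` operator half `‖G‖ ≤ B` is a theorem at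
`B = (γco L)⁻¹` (its (115)-jet sup∕Hölder half is the one-form GRADIENT storey, not here).
HONEST SCOPE.  Composition of landed theorems; no new estimate of print is proved here; `Lift` is displayed (discharged at the junction by ✓`hIrrLift_of_record`); nothing of the 8 EX
print rows, `hThm2S`, EX `stub_existenceMinimalOrbit` or the crux is proved; nothing continuum ∕ OS ∕ mass-gap ∕ Clay.

References: T. Bałaban, CMP **99** (1985) 389–434 [Balaban1985BackgroundPropagators] (Thm 3.3 p.398, Thm 3.11 p.416, (3.21)–(3.27) pp.394–395, (3.115) p.418, (3.118)–(3.122) pp.419–420); CMP **95** (1984) 17–40 [Balaban1984PropagatorsI] (Prop. 1.1 (1.90) p.33); CMP **102** (1985) 277–309 [Balaban1985Variational] ((110)–(111) p.294).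
-/

set_option autoImplicit false

noncomputable section

open scoped InnerProductSpace ComplexConjugate Matrix.Norms.L2Operator BigOperators

namespace Summit.QuantumFields.YangMills.Theorems.Prop7OneFormCoerciveHolds

open Literature.MathematicalPhysics.QuantumFieldTheory.Balaban1983to89
open Literature.MathematicalPhysics.QuantumFieldTheory.Balaban1983to89.T3ContinuumYM3Torus
open T4Continuum BlockAveraging
open BlockAveraging (Idx)
open B7Prop1Explicit (disp)
open B10Eq27TorusAxialLog (holT transl)
open B7TransferAnalyticMean (meanCLM)
open B11Eq103H1Complex (SiteL2K BondL2K projR)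
open B15DeterminingSets (embIter)
open Summit.QuantumFields.YangMills.Theorems.Prop8Chart (emlIterU)
open T3PrintedRegularMinimiser (RegPr)
open T3PrintedMinimiserExistence (regPr_mono)
open T3SectALandauChart (bgUnits)
open Summit.QuantumFields.YangMills.Theorems.Prop7SectET3Transport (periodsT3)
open Summit.QuantumFields.YangMills.Theorems.Prop7SectET3HilbertLetters (W₂ toL2S DL2 DstarL2 covLapSite)
open Summit.QuantumFields.YangMills.Theorems.Prop7SectET3GaugeProjector (NS RS)
open Summit.QuantumFields.YangMills.Theorems.Prop7SectET3WilsonHessian (DeltaEta DeltaEtaSlot DeltaEtaSlot_apply)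
open Summit.QuantumFields.YangMills.Theorems.Prop7SectET3CurvedPropagators (Qk laplaceA PosOnto GT laplaceA_GT)
open Summit.QuantumFields.YangMills.Theorems.Prop7LiftOfRSEqPrintProjector (RS_eq_projR_iff_lift)
open Summit.QuantumFields.YangMills.Theorems.Prop7NSIntertwinerOfRecord (exists_intertwiner_of_regPr)
open Summit.QuantumFields.YangMills.Theorems.Prop7LaplaceAFlatCoercive (re_inner_laplaceA)
open Summit.QuantumFields.YangMills.Theorems.Prop7LODTargetExists (hT_exists)
open Summit.QuantumFields.YangMills.Theorems.Prop7SectET3DeltaPiPInv (DeltaPiSlotP)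
open Summit.QuantumFields.YangMills.Theorems.Prop7GaugeFixedRowDoorOfLODTarget (gaugeFixedRow_of_curvedTarget)
open Summit.QuantumFields.YangMills.Theorems.Prop7CoerciveOfGaugeFixedLift (coercive_laplaceA_piSlot_of_gaugeFixed_of_lift)

variable {F : T3Family} {n K : ℕ} (h : n ≤ K) {c₀ : ℝ} [Fact (0 < c₀)] (cB : ℝ) [Fact (0 < cB)]

/-! ## §1 The member door: curved target for every `Q″` of record + `Lift` ⟹ full coercivity of `Δ_a(U₀)`, same constant -/

/-- ★★★ **THE (γ) DOOR AT THE MEMBER.**  At a printed-regular background `U₀` (`RegPr F n K ε₀ U₀`, `0 < ε₀`, `10¹²L³ε₀ ≤ 1`): if the CURVED TARGET of the LOD line holds for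
every top nested mean `Q″` of record at coupling `a` (`hT`, the shape of ✓`Prop7GaugeFixedRowDoorOfLODTarget.gaugeFixedRow_of_curvedTarget`'s hypothesis — ALL `A`, no slice
antecedent), then ON THE LIFT LOCUS the member's `Δ_{a′}(U₀) = Δx(U₀) + D R_S D* + Q_k†a′Q_k` is coercive with the SAME constant for every slot `Δx` that is `Δ^η(U₀)` at `U₀` and every
coupling `a′ ≥ a`: `∀ v, γ‖v‖² ≤ re⟪v, Δ_{a′}(U₀) v⟫`.  PROOF: the `Q″` of record (✓`exists_intertwiner_of_regPr`), `R_S(U₀) = projR (Δ^η_{U₀}) Q″` under Lift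
(✓`RS_eq_projR_iff_lift`), the three-term form ✓`re_inner_laplaceA`, monotonicity in the coupling.
[cite: Balaban1985BackgroundPropagators, Thm 3.11 p.416, (3.21)–(3.27) pp.394–395, (3.115) p.418] -/
theorem coercive_laplaceA_of_curvedTarget_of_lift {ε₀ : ℝ} (hε₀ : 0 < ε₀) (hWε : 10 ^ 12 * (F.L : ℝ) ^ 3 * ε₀ ≤ 1)
    (U₀ : GaugeField (F.P K) 0 (Matrix.specialUnitaryGroup (Fin 2) ℂ)) (hreg : RegPr F n K ε₀ U₀) {γ a a' : ℝ} (haa : a ≤ a')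
    (Δx : GaugeField (F.P K) 0 (Matrix.specialUnitaryGroup (Fin 2) ℂ) → (BondL2K ℂ 3 (periodsT3 F K) c₀ W₂ →ₗ[ℂ] BondL2K ℂ 3 (periodsT3 F K) c₀ W₂))
    (hΔx : ∀ v : BondL2K ℂ 3 (periodsT3 F K) c₀ W₂, Δx U₀ v = DeltaEta F n K c₀ U₀ v)
    (hT : ∀ (Q'' : SiteL2K ℂ 3 (periodsT3 F K) c₀ W₂ →ₗ[ℂ] (Site (F.P K) (K - n) → Matrix (Fin 2) (Fin 2) ℂ)),
      (∀ (lam : Site (F.P K) 0 → Matrix (Fin 2) (Fin 2) ℂ) (ns : (j : ℕ) → Site (F.P K) j → Matrix (Fin 2) (Fin 2) ℂ), ns 0 = lam →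
        (∀ (j : ℕ) (y : Site (F.P K) (j + 1)), ns (j + 1) y = ns j (emb y) - meanCLM (Idx (F.P K)) (Matrix (Fin 2) (Fin 2) ℂ) fun i : Idx (F.P K) =>
          ns j (emb y) - ((holT (emlIterU j (bgUnits F K U₀)) (emb y) (stairWord i.2.1 (off i.1)) : (Matrix (Fin 2) (Fin 2) ℂ)ˣ) : Matrix (Fin 2) (Fin 2) ℂ) *
            ns j (transl (emb y) (disp (stairWord i.2.1 (off i.1)))) * (((holT (emlIterU j (bgUnits F K U₀)) (emb y) (stairWord i.2.1 (off i.1)))⁻¹ : (Matrix (Fin 2) (Fin 2) ℂ)ˣ) : Matrix (Fin 2) (Fin 2) ℂ)) →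
        ns (K - n) = Q'' (toL2S F K c₀ lam)) →
      LinearMap.ker Q'' ≤ NS F n K h c₀ cB U₀ →
      ∀ A : BondL2K ℂ 3 (periodsT3 F K) c₀ W₂,
        γ * ‖A‖ ^ 2 ≤ RCLike.re ⟪A, DeltaEta F n K c₀ U₀ A⟫_ℂ
          + ‖projR (covLapSite F n K c₀ U₀) Q'' (DstarL2 F n K c₀ U₀ A)‖ ^ 2 + a * ‖Qk F n K h c₀ cB U₀ A‖ ^ 2)
    (hlift : ∀ cf : Site (F.P K) (K - n) → Matrix (Fin 2) (Fin 2) ℂ,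
        (∀ e : PBond (F.P K) (K - n), cf e.src = ((emlIterU (K - n) (bgUnits F K U₀) e : (Matrix (Fin 2) (Fin 2) ℂ)ˣ) : Matrix (Fin 2) (Fin 2) ℂ) * cf e.tgt *
          (((emlIterU (K - n) (bgUnits F K U₀) e)⁻¹ : (Matrix (Fin 2) (Fin 2) ℂ)ˣ) : Matrix (Fin 2) (Fin 2) ℂ)) →
        ∃ l₀ : Site (F.P K) 0 → Matrix (Fin 2) (Fin 2) ℂ,
          (∀ b : PBond (F.P K) 0, l₀ b.src = ((bgUnits F K U₀ b : (Matrix (Fin 2) (Fin 2) ℂ)ˣ) : Matrix (Fin 2) (Fin 2) ℂ) * l₀ b.tgt * (((bgUnits F K U₀ b)⁻¹ : (Matrix (Fin 2) (Fin 2) ℂ)ˣ) : Matrix (Fin 2) (Fin 2) ℂ)) ∧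
          ∀ y : Site (F.P K) (K - n), l₀ (embIter (K - n) y) = cf y) :
    ∀ v : BondL2K ℂ 3 (periodsT3 F K) c₀ W₂,
      γ * ‖v‖ ^ 2 ≤ RCLike.re ⟪v, laplaceA F n K h c₀ cB a' Δx U₀ v⟫_ℂ := by
  intro v
  obtain ⟨Q'', _D', _hint, _hD', htop, _hseq, hker⟩ := exists_intertwiner_of_regPr (F := F) (c₀ := c₀) h cB hε₀ hWε U₀ hreg
  have hRS : RS F n K h c₀ cB U₀ = projR (covLapSite F n K c₀ U₀) Q'' :=
    (RS_eq_projR_iff_lift (F := F) h cB hε₀ hWε U₀ hreg Q'' htop hker).2 hlift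
  have h1 := hT Q'' htop hker v
  have h2 : a * ‖Qk F n K h c₀ cB U₀ v‖ ^ 2 ≤ a' * ‖Qk F n K h c₀ cB U₀ v‖ ^ 2 := mul_le_mul_of_nonneg_right haa (sq_nonneg _)
  rw [re_inner_laplaceA a' Δx U₀ v, hΔx v, hRS]
  linarith

/-- ★★ **THE (γ) LETTER OF THE ONE-FORM STOREY AT THE MEMBER** — the E2E slot `Δx := DeltaEtaSlot` (`DeltaEtaSlot U₀ v = Δ^η(U₀) v` by `rfl`): under `RegPr` + the curved target
for every `Q″` of record + `Lift`, `∀ v, γ‖v‖² ≤ re⟪v, laplaceA F n K h c₀ cB a′ (DeltaEtaSlot F n K c₀) U₀ v⟫` for every `a′ ≥ a` — the `hco` hypothesis of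
✓`Prop7OneFormBlockDecayAll.blockDecay_allBlocks_of_letters` ∕ ✓`Prop7OneFormPointwiseDecayE2E.pointwiseDecay_oneForm_DeltaEtaSlot` ∕ ✓`Prop7OneFormGreenKernelRow.kernelRow_GT_DeltaEtaSlot`
VERBATIM. [cite: Balaban1985BackgroundPropagators, Thm 3.11 p.416, (3.26) p.395] -/
theorem coercive_laplaceA_DeltaEtaSlot_of_curvedTarget_of_lift {ε₀ : ℝ} (hε₀ : 0 < ε₀) (hWε : 10 ^ 12 * (F.L : ℝ) ^ 3 * ε₀ ≤ 1)
    (U₀ : GaugeField (F.P K) 0 (Matrix.specialUnitaryGroup (Fin 2) ℂ)) (hreg : RegPr F n K ε₀ U₀) {γ a a' : ℝ} (haa : a ≤ a')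
    (hT : ∀ (Q'' : SiteL2K ℂ 3 (periodsT3 F K) c₀ W₂ →ₗ[ℂ] (Site (F.P K) (K - n) → Matrix (Fin 2) (Fin 2) ℂ)),
      (∀ (lam : Site (F.P K) 0 → Matrix (Fin 2) (Fin 2) ℂ) (ns : (j : ℕ) → Site (F.P K) j → Matrix (Fin 2) (Fin 2) ℂ), ns 0 = lam →
        (∀ (j : ℕ) (y : Site (F.P K) (j + 1)), ns (j + 1) y = ns j (emb y) - meanCLM (Idx (F.P K)) (Matrix (Fin 2) (Fin 2) ℂ) fun i : Idx (F.P K) =>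
          ns j (emb y) - ((holT (emlIterU j (bgUnits F K U₀)) (emb y) (stairWord i.2.1 (off i.1)) : (Matrix (Fin 2) (Fin 2) ℂ)ˣ) : Matrix (Fin 2) (Fin 2) ℂ) *
            ns j (transl (emb y) (disp (stairWord i.2.1 (off i.1)))) * (((holT (emlIterU j (bgUnits F K U₀)) (emb y) (stairWord i.2.1 (off i.1)))⁻¹ : (Matrix (Fin 2) (Fin 2) ℂ)ˣ) : Matrix (Fin 2) (Fin 2) ℂ)) →
        ns (K - n) = Q'' (toL2S F K c₀ lam)) →
      LinearMap.ker Q'' ≤ NS F n K h c₀ cB U₀ →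
      ∀ A : BondL2K ℂ 3 (periodsT3 F K) c₀ W₂,
        γ * ‖A‖ ^ 2 ≤ RCLike.re ⟪A, DeltaEta F n K c₀ U₀ A⟫_ℂ
          + ‖projR (covLapSite F n K c₀ U₀) Q'' (DstarL2 F n K c₀ U₀ A)‖ ^ 2 + a * ‖Qk F n K h c₀ cB U₀ A‖ ^ 2)
    (hlift : ∀ cf : Site (F.P K) (K - n) → Matrix (Fin 2) (Fin 2) ℂ,
        (∀ e : PBond (F.P K) (K - n), cf e.src = ((emlIterU (K - n) (bgUnits F K U₀) e : (Matrix (Fin 2) (Fin 2) ℂ)ˣ) : Matrix (Fin 2) (Fin 2) ℂ) * cf e.tgt *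
          (((emlIterU (K - n) (bgUnits F K U₀) e)⁻¹ : (Matrix (Fin 2) (Fin 2) ℂ)ˣ) : Matrix (Fin 2) (Fin 2) ℂ)) →
        ∃ l₀ : Site (F.P K) 0 → Matrix (Fin 2) (Fin 2) ℂ,
          (∀ b : PBond (F.P K) 0, l₀ b.src = ((bgUnits F K U₀ b : (Matrix (Fin 2) (Fin 2) ℂ)ˣ) : Matrix (Fin 2) (Fin 2) ℂ) * l₀ b.tgt * (((bgUnits F K U₀ b)⁻¹ : (Matrix (Fin 2) (Fin 2) ℂ)ˣ) : Matrix (Fin 2) (Fin 2) ℂ)) ∧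
          ∀ y : Site (F.P K) (K - n), l₀ (embIter (K - n) y) = cf y) :
    ∀ v : BondL2K ℂ 3 (periodsT3 F K) c₀ W₂,
      γ * ‖v‖ ^ 2 ≤ RCLike.re ⟪v, laplaceA F n K h c₀ cB a' (DeltaEtaSlot F n K c₀) U₀ v⟫_ℂ :=
  coercive_laplaceA_of_curvedTarget_of_lift h cB hε₀ hWε U₀ hreg haa (DeltaEtaSlot F n K c₀) (fun v => DeltaEtaSlot_apply U₀ v) hT hlift

/-- ★★ **THE SLOT WITH A J-TERM** (`Δx U₀ = Δ^η(U₀) + T(U₀)`, `re⟪v, T(U₀) v⟫ ≥ −τ‖v‖²` — the `DeltaEtaSlot + TJSlotP` slot of the `KinvT`∕`GT` rows of the EX display, or any bounded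
J-term): under the same antecedents, `∀ v, (γ − τ)‖v‖² ≤ re⟪v, Δ_{a′}(Δx)(U₀) v⟫`. [cite: Balaban1985BackgroundPropagators, Thm 3.11 p.416, (3.26) p.395; Balaban1985Variational, (110) p.294] -/
theorem coercive_laplaceA_add_of_curvedTarget_of_lift {ε₀ : ℝ} (hε₀ : 0 < ε₀) (hWε : 10 ^ 12 * (F.L : ℝ) ^ 3 * ε₀ ≤ 1)
    (U₀ : GaugeField (F.P K) 0 (Matrix.specialUnitaryGroup (Fin 2) ℂ)) (hreg : RegPr F n K ε₀ U₀) {γ a a' τ : ℝ} (haa : a ≤ a')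
    (Δx T : GaugeField (F.P K) 0 (Matrix.specialUnitaryGroup (Fin 2) ℂ) → (BondL2K ℂ 3 (periodsT3 F K) c₀ W₂ →ₗ[ℂ] BondL2K ℂ 3 (periodsT3 F K) c₀ W₂))
    (hΔx : ∀ v : BondL2K ℂ 3 (periodsT3 F K) c₀ W₂, Δx U₀ v = DeltaEta F n K c₀ U₀ v + T U₀ v)
    (hTτ : ∀ v : BondL2K ℂ 3 (periodsT3 F K) c₀ W₂, -τ * ‖v‖ ^ 2 ≤ RCLike.re ⟪v, T U₀ v⟫_ℂ)
    (hT : ∀ (Q'' : SiteL2K ℂ 3 (periodsT3 F K) c₀ W₂ →ₗ[ℂ] (Site (F.P K) (K - n) → Matrix (Fin 2) (Fin 2) ℂ)),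
      (∀ (lam : Site (F.P K) 0 → Matrix (Fin 2) (Fin 2) ℂ) (ns : (j : ℕ) → Site (F.P K) j → Matrix (Fin 2) (Fin 2) ℂ), ns 0 = lam →
        (∀ (j : ℕ) (y : Site (F.P K) (j + 1)), ns (j + 1) y = ns j (emb y) - meanCLM (Idx (F.P K)) (Matrix (Fin 2) (Fin 2) ℂ) fun i : Idx (F.P K) =>
          ns j (emb y) - ((holT (emlIterU j (bgUnits F K U₀)) (emb y) (stairWord i.2.1 (off i.1)) : (Matrix (Fin 2) (Fin 2) ℂ)ˣ) : Matrix (Fin 2) (Fin 2) ℂ) *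
            ns j (transl (emb y) (disp (stairWord i.2.1 (off i.1)))) * (((holT (emlIterU j (bgUnits F K U₀)) (emb y) (stairWord i.2.1 (off i.1)))⁻¹ : (Matrix (Fin 2) (Fin 2) ℂ)ˣ) : Matrix (Fin 2) (Fin 2) ℂ)) →
        ns (K - n) = Q'' (toL2S F K c₀ lam)) →
      LinearMap.ker Q'' ≤ NS F n K h c₀ cB U₀ →
      ∀ A : BondL2K ℂ 3 (periodsT3 F K) c₀ W₂,
        γ * ‖A‖ ^ 2 ≤ RCLike.re ⟪A, DeltaEta F n K c₀ U₀ A⟫_ℂ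
          + ‖projR (covLapSite F n K c₀ U₀) Q'' (DstarL2 F n K c₀ U₀ A)‖ ^ 2 + a * ‖Qk F n K h c₀ cB U₀ A‖ ^ 2)
    (hlift : ∀ cf : Site (F.P K) (K - n) → Matrix (Fin 2) (Fin 2) ℂ,
        (∀ e : PBond (F.P K) (K - n), cf e.src = ((emlIterU (K - n) (bgUnits F K U₀) e : (Matrix (Fin 2) (Fin 2) ℂ)ˣ) : Matrix (Fin 2) (Fin 2) ℂ) * cf e.tgt *
          (((emlIterU (K - n) (bgUnits F K U₀) e)⁻¹ : (Matrix (Fin 2) (Fin 2) ℂ)ˣ) : Matrix (Fin 2) (Fin 2) ℂ)) →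
        ∃ l₀ : Site (F.P K) 0 → Matrix (Fin 2) (Fin 2) ℂ,
          (∀ b : PBond (F.P K) 0, l₀ b.src = ((bgUnits F K U₀ b : (Matrix (Fin 2) (Fin 2) ℂ)ˣ) : Matrix (Fin 2) (Fin 2) ℂ) * l₀ b.tgt * (((bgUnits F K U₀ b)⁻¹ : (Matrix (Fin 2) (Fin 2) ℂ)ˣ) : Matrix (Fin 2) (Fin 2) ℂ)) ∧
          ∀ y : Site (F.P K) (K - n), l₀ (embIter (K - n) y) = cf y) :
    ∀ v : BondL2K ℂ 3 (periodsT3 F K) c₀ W₂,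
      (γ - τ) * ‖v‖ ^ 2 ≤ RCLike.re ⟪v, laplaceA F n K h c₀ cB a' Δx U₀ v⟫_ℂ := by
  intro v
  obtain ⟨Q'', _D', _hint, _hD', htop, _hseq, hker⟩ := exists_intertwiner_of_regPr (F := F) (c₀ := c₀) h cB hε₀ hWε U₀ hreg
  have hRS : RS F n K h c₀ cB U₀ = projR (covLapSite F n K c₀ U₀) Q'' :=
    (RS_eq_projR_iff_lift (F := F) h cB hε₀ hWε U₀ hreg Q'' htop hker).2 hlift
  have h1 := hT Q'' htop hker v
  have h2 : a * ‖Qk F n K h c₀ cB U₀ v‖ ^ 2 ≤ a' * ‖Qk F n K h c₀ cB U₀ v‖ ^ 2 := mul_le_mul_of_nonneg_right haa (sq_nonneg _)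
  have h3 := hTτ v
  rw [re_inner_laplaceA a' Δx U₀ v, hΔx v, inner_add_right, map_add, hRS]
  linarith

/-! ## §2 The class `PosOnto` and the `L²` half of the EX row `norm_G`: `‖G(U₀) f‖ ≤ γ⁻¹‖f‖` from coercivity -/

/-- ★★ **COERCIVITY WITH `γ > 0` ⟹ THE CLASS `PosOnto`** (`Δ_a(U₀)` positive definite; `Q_k(U₀)` onto under `RegPr` in the window `13·10¹⁴L³ε₀ ≤ 1`, `n < K`, by
✓`Prop7QkOntoOfRegPr.surjective_Qk_of_regPr`) — so the total letters `GT`, `KinvT`, `HT`, `frakGfR` ARE print's `G`, `(QGQ*)⁻¹`, `H`, `𝔊` at `U₀`.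
[cite: Balaban1985BackgroundPropagators, Thm 3.11 p.416, (3.19) p.393, (3.27) p.395] -/
theorem posOnto_of_coercive (hnK : n < K) {ε₀ : ℝ} {U₀ : GaugeField (F.P K) 0 (Matrix.specialUnitaryGroup (Fin 2) ℂ)} (hreg : RegPr F n K ε₀ U₀)
    (hwin : 13 * 10 ^ 14 * (F.L : ℝ) ^ 3 * ε₀ ≤ 1) {a γ : ℝ} (hγ : 0 < γ)
    (Δx : GaugeField (F.P K) 0 (Matrix.specialUnitaryGroup (Fin 2) ℂ) → (BondL2K ℂ 3 (periodsT3 F K) c₀ W₂ →ₗ[ℂ] BondL2K ℂ 3 (periodsT3 F K) c₀ W₂))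
    (hco : ∀ v : BondL2K ℂ 3 (periodsT3 F K) c₀ W₂, γ * ‖v‖ ^ 2 ≤ RCLike.re ⟪v, laplaceA F n K h c₀ cB a Δx U₀ v⟫_ℂ) :
    PosOnto F n K h c₀ cB a Δx U₀ := by
  refine ⟨fun x hx => ?_, ?_⟩
  · exact lt_of_lt_of_le (mul_pos hγ (pow_pos (norm_pos_iff.mpr hx) 2)) (hco x)
  · exact Prop7QkOntoOfRegPr.surjective_Qk_of_regPr F h hnK c₀ cB hreg hwin

/-- ★★★ **THE `L²` HALF OF THE EX ROW `norm_G`: `‖G(U₀) f‖ ≤ γ⁻¹·‖f‖`** for the member's total letter `G = GT … a Δx U₀ = Δ_a(U₀)⁻¹` on the class — Lax–Milgram by hand: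
`γ‖Gf‖² ≤ re⟪Gf, Δ_a Gf⟫ = re⟪Gf, f⟫ ≤ ‖Gf‖·‖f‖` (✓`laplaceA_GT`).  With §1∕§4 this is print's Thm 3.3 (3.47) `|G|` row in the `L²` operator currency, K-uniform.
[cite: Balaban1985BackgroundPropagators, Thm 3.3 (3.47) p.398, Thm 3.11 p.416, (3.27) p.395] -/
theorem norm_GT_le_of_coercive (hnK : n < K) {ε₀ : ℝ} {U₀ : GaugeField (F.P K) 0 (Matrix.specialUnitaryGroup (Fin 2) ℂ)} (hreg : RegPr F n K ε₀ U₀)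
    (hwin : 13 * 10 ^ 14 * (F.L : ℝ) ^ 3 * ε₀ ≤ 1) {a γ : ℝ} (hγ : 0 < γ)
    (Δx : GaugeField (F.P K) 0 (Matrix.specialUnitaryGroup (Fin 2) ℂ) → (BondL2K ℂ 3 (periodsT3 F K) c₀ W₂ →ₗ[ℂ] BondL2K ℂ 3 (periodsT3 F K) c₀ W₂))
    (hco : ∀ v : BondL2K ℂ 3 (periodsT3 F K) c₀ W₂, γ * ‖v‖ ^ 2 ≤ RCLike.re ⟪v, laplaceA F n K h c₀ cB a Δx U₀ v⟫_ℂ)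
    (f : BondL2K ℂ 3 (periodsT3 F K) c₀ W₂) :
    ‖GT F n K h c₀ cB a Δx U₀ f‖ ≤ γ⁻¹ * ‖f‖ := by
  have hp := posOnto_of_coercive h cB hnK hreg hwin hγ Δx hco
  set g := GT F n K h c₀ cB a Δx U₀ f with hg
  have h1 := hco g
  rw [hg, laplaceA_GT hp f, ← hg] at h1
  have h2 : RCLike.re ⟪g, f⟫_ℂ ≤ ‖g‖ * ‖f‖ := re_inner_le_norm g f
  have h3 : γ * ‖g‖ ^ 2 ≤ ‖g‖ * ‖f‖ := h1.trans h2
  rw [← div_eq_inv_mul, le_div_iff₀ hγ]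
  rcases (norm_nonneg g).eq_or_lt with h0 | hpos
  · rw [← h0, zero_mul]; positivity
  · nlinarith [norm_nonneg f]

/-! ## §3 The door at the display's index `T3Thm1Carrier.Idx L`: the `hT` binder of ✓`gaugeFixedRow_idx_of_curvedTarget_of_le_coupling` VERBATIM ⟹ `hco` -/

/-- ★★★ **THE (γ) DOOR AT THE DISPLAY'S INDEX** (letters `αcap c₀ cB aLOD a γ`, index `i : T3Thm1Carrier.Idx L` = `(F, n, K)` with `F.L = L`, `n < K`): if the LOD line proves the curved
target `hT` at the cap `RegPr (αcap L) U₀` for every member and every top nested mean of record (the `hT` binder of ✓`Prop7GaugeFixedRowDoorOfLODTarget.gaugeFixedRow_idx_of_curvedTarget_of_le_coupling`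
VERBATIM, = (E4) of ✓`hT_exists`) and the cap obeys `10¹²L³·αcap L ≤ 1`, then for every `ρ ≤ αcap L`, every `RegPr ρ U₀`, ON THE LIFT LOCUS, and every display coupling
`a L i ≥ aLOD L i`: `∀ v, γ L·‖v‖² ≤ re⟪v, laplaceA … (a L i) (DeltaEtaSlot …) U₀ v⟫`. [cite: Balaban1985BackgroundPropagators, Thm 3.3 p.398, Thm 3.11 p.416] -/
theorem coercive_laplaceA_idx_of_curvedTarget_of_le_coupling (αcap : ℕ → ℝ) (hαcap : ∀ L : ℕ, 1 < L → 0 < αcap L)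
    (hWα : ∀ L : ℕ, 1 < L → 10 ^ 12 * (L : ℝ) ^ 3 * αcap L ≤ 1)
    (c₀ cB : ℕ → ℝ) [hc₀ : ∀ L : ℕ, Fact (0 < c₀ L)] [hcB : ∀ L : ℕ, Fact (0 < cB L)] (aLOD a : ∀ L : ℕ, T3Thm1Carrier.Idx L → ℝ)
    (ha : ∀ (L : ℕ) (i : T3Thm1Carrier.Idx L), aLOD L i ≤ a L i) (γ : ℕ → ℝ)
    (hT : ∀ (L : ℕ), 1 < L → ∀ (i : T3Thm1Carrier.Idx L) (U₀ : GaugeField (i.1.1.P i.1.2.2) 0 (Matrix.specialUnitaryGroup (Fin 2) ℂ)),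
      RegPr i.1.1 i.1.2.1 i.1.2.2 (αcap L) U₀ →
      ∀ (Q'' : SiteL2K ℂ 3 (periodsT3 i.1.1 i.1.2.2) (c₀ L) W₂ →ₗ[ℂ] (Site (i.1.1.P i.1.2.2) (i.1.2.2 - i.1.2.1) → Matrix (Fin 2) (Fin 2) ℂ)),
        (∀ (lam : Site (i.1.1.P i.1.2.2) 0 → Matrix (Fin 2) (Fin 2) ℂ) (ns : (j : ℕ) → Site (i.1.1.P i.1.2.2) j → Matrix (Fin 2) (Fin 2) ℂ), ns 0 = lam →
          (∀ (j : ℕ) (y : Site (i.1.1.P i.1.2.2) (j + 1)), ns (j + 1) y = ns j (emb y) - meanCLM (Idx (i.1.1.P i.1.2.2)) (Matrix (Fin 2) (Fin 2) ℂ) fun ι : Idx (i.1.1.P i.1.2.2) =>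
            ns j (emb y) - ((holT (emlIterU j (bgUnits i.1.1 i.1.2.2 U₀)) (emb y) (stairWord ι.2.1 (off ι.1)) : (Matrix (Fin 2) (Fin 2) ℂ)ˣ) : Matrix (Fin 2) (Fin 2) ℂ) *
              ns j (transl (emb y) (disp (stairWord ι.2.1 (off ι.1)))) * (((holT (emlIterU j (bgUnits i.1.1 i.1.2.2 U₀)) (emb y) (stairWord ι.2.1 (off ι.1)))⁻¹ : (Matrix (Fin 2) (Fin 2) ℂ)ˣ) : Matrix (Fin 2) (Fin 2) ℂ)) →
          ns (i.1.2.2 - i.1.2.1) = Q'' (toL2S i.1.1 i.1.2.2 (c₀ L) lam)) →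
        LinearMap.ker Q'' ≤ NS i.1.1 i.1.2.1 i.1.2.2 i.2.2.le (c₀ L) (cB L) U₀ →
        ∀ A : BondL2K ℂ 3 (periodsT3 i.1.1 i.1.2.2) (c₀ L) W₂,
          γ L * ‖A‖ ^ 2 ≤ RCLike.re ⟪A, DeltaEta i.1.1 i.1.2.1 i.1.2.2 (c₀ L) U₀ A⟫_ℂ
            + ‖projR (covLapSite i.1.1 i.1.2.1 i.1.2.2 (c₀ L) U₀) Q'' (DstarL2 i.1.1 i.1.2.1 i.1.2.2 (c₀ L) U₀ A)‖ ^ 2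
            + aLOD L i * ‖Qk i.1.1 i.1.2.1 i.1.2.2 i.2.2.le (c₀ L) (cB L) U₀ A‖ ^ 2) :
    ∀ (L : ℕ), 1 < L → ∀ (i : T3Thm1Carrier.Idx L) (U₀ : GaugeField (i.1.1.P i.1.2.2) 0 (Matrix.specialUnitaryGroup (Fin 2) ℂ)), ∀ ρ : ℝ, RegPr i.1.1 i.1.2.1 i.1.2.2 ρ U₀ → ρ ≤ αcap L →
        (∀ cf : Site (i.1.1.P i.1.2.2) (i.1.2.2 - i.1.2.1) → Matrix (Fin 2) (Fin 2) ℂ,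
        (∀ e' : PBond (i.1.1.P i.1.2.2) (i.1.2.2 - i.1.2.1), cf e'.src = ((emlIterU (i.1.2.2 - i.1.2.1) (bgUnits i.1.1 i.1.2.2 U₀) e' : (Matrix (Fin 2) (Fin 2) ℂ)ˣ) : Matrix (Fin 2) (Fin 2) ℂ) * cf e'.tgt *
        (((emlIterU (i.1.2.2 - i.1.2.1) (bgUnits i.1.1 i.1.2.2 U₀) e')⁻¹ : (Matrix (Fin 2) (Fin 2) ℂ)ˣ) : Matrix (Fin 2) (Fin 2) ℂ)) →
        ∃ l₀ : Site (i.1.1.P i.1.2.2) 0 → Matrix (Fin 2) (Fin 2) ℂ,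
        (∀ b' : PBond (i.1.1.P i.1.2.2) 0, l₀ b'.src = ((bgUnits i.1.1 i.1.2.2 U₀ b' : (Matrix (Fin 2) (Fin 2) ℂ)ˣ) : Matrix (Fin 2) (Fin 2) ℂ) * l₀ b'.tgt * (((bgUnits i.1.1 i.1.2.2 U₀ b')⁻¹ : (Matrix (Fin 2) (Fin 2) ℂ)ˣ) : Matrix (Fin 2) (Fin 2) ℂ)) ∧
        ∀ y : Site (i.1.1.P i.1.2.2) (i.1.2.2 - i.1.2.1), l₀ (embIter (i.1.2.2 - i.1.2.1) y) = cf y) →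
      ∀ v : BondL2K ℂ 3 (periodsT3 i.1.1 i.1.2.2) (c₀ L) W₂,
        γ L * ‖v‖ ^ 2 ≤ RCLike.re ⟪v, laplaceA i.1.1 i.1.2.1 i.1.2.2 i.2.2.le (c₀ L) (cB L) (a L i) (DeltaEtaSlot i.1.1 i.1.2.1 i.1.2.2 (c₀ L)) U₀ v⟫_ℂ := by
  intro L hL i U₀ ρ hreg hρ hlift
  have hFL : (i.1.1.L : ℝ) = (L : ℝ) := by rw [i.2.1]
  have hWε : 10 ^ 12 * (i.1.1.L : ℝ) ^ 3 * αcap L ≤ 1 := by rw [hFL]; exact hWα L hL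
  exact coercive_laplaceA_DeltaEtaSlot_of_curvedTarget_of_lift (F := i.1.1) (n := i.1.2.1) (K := i.1.2.2) (c₀ := c₀ L) i.2.2.le (cB L) (hαcap L hL) hWε U₀
    (regPr_mono (F := i.1.1) hρ hreg) (ha L i) (hT L hL i U₀ (regPr_mono (F := i.1.1) hρ hreg)) hlift

/-! ## §4 The (γ) letter `∃`-packaged (the `hT_exists` export shape): `hco` and `‖G‖ ≤ γ⁻¹` at every member, K-uniformly, under `Lift` -/

/-- ★★★★ **THE (γ) LETTER OF THE ONE-FORM STOREY HOLDS, `∃`-PACKAGED.**  For weights `c₀ cB : ℕ → ℝ` (positive) and a comparison constant `a₀ > 0` there are letter families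
`αco γco : ℕ → ℝ` with (C1) `0 < αco L`, (C2) `10¹²L³·αco L ≤ 1`, (C3) `13·10¹⁴L³·αco L ≤ 1`, (C4) `0 < γco L` (all for `1 < L`), and (C5) for every member `i = (F, n < K)`,
`F.L = L`, every `RegPr ρ U₀` with `ρ ≤ αco L`, ON THE LIFT LOCUS, and every coupling `a ≥ a₀·(c₀ L∕cB L)·(L^{K−n})³`:
`∀ v, γco L·‖v‖² ≤ re⟪v, laplaceA … a (DeltaEtaSlot …) U₀ v⟫` — the `hco` hypothesis of A1∕A3∕A4∕A4b∕O4-E2E∕(K2) VERBATIM.  PROOF: ✓`hT_exists` (the LOD ∕ IMS ∕ Combes–Thomas line,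
S45) gives `αLOD γLOD`; `αco := min αLOD (13·10¹⁴L³)⁻¹`, `γco := γLOD`; §1 at the member.  K-UNIFORM: `γco` depends on `L` only.
[cite: Balaban1985BackgroundPropagators, Thm 3.3 p.398, Thm 3.11 p.416, (3.26)–(3.27) p.395; Balaban1984PropagatorsI, Prop. 1.1 (1.90) p.33] -/
theorem hco_DeltaEtaSlot_exists (c₀ cB : ℕ → ℝ) [hc₀ : ∀ L : ℕ, Fact (0 < c₀ L)] [hcB : ∀ L : ℕ, Fact (0 < cB L)] {a₀ : ℝ} (ha₀ : 0 < a₀) :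
    ∃ (αco γco : ℕ → ℝ),
      (∀ L : ℕ, 1 < L → 0 < αco L) ∧ (∀ L : ℕ, 1 < L → 10 ^ 12 * (L : ℝ) ^ 3 * αco L ≤ 1) ∧ (∀ L : ℕ, 1 < L → 13 * 10 ^ 14 * (L : ℝ) ^ 3 * αco L ≤ 1) ∧
      (∀ L : ℕ, 1 < L → 0 < γco L) ∧
    ∀ (L : ℕ), 1 < L → ∀ (i : T3Thm1Carrier.Idx L) (U₀ : GaugeField (i.1.1.P i.1.2.2) 0 (Matrix.specialUnitaryGroup (Fin 2) ℂ)), ∀ ρ : ℝ, RegPr i.1.1 i.1.2.1 i.1.2.2 ρ U₀ → ρ ≤ αco L →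
        (∀ cf : Site (i.1.1.P i.1.2.2) (i.1.2.2 - i.1.2.1) → Matrix (Fin 2) (Fin 2) ℂ,
        (∀ e' : PBond (i.1.1.P i.1.2.2) (i.1.2.2 - i.1.2.1), cf e'.src = ((emlIterU (i.1.2.2 - i.1.2.1) (bgUnits i.1.1 i.1.2.2 U₀) e' : (Matrix (Fin 2) (Fin 2) ℂ)ˣ) : Matrix (Fin 2) (Fin 2) ℂ) * cf e'.tgt *
        (((emlIterU (i.1.2.2 - i.1.2.1) (bgUnits i.1.1 i.1.2.2 U₀) e')⁻¹ : (Matrix (Fin 2) (Fin 2) ℂ)ˣ) : Matrix (Fin 2) (Fin 2) ℂ)) →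
        ∃ l₀ : Site (i.1.1.P i.1.2.2) 0 → Matrix (Fin 2) (Fin 2) ℂ,
        (∀ b' : PBond (i.1.1.P i.1.2.2) 0, l₀ b'.src = ((bgUnits i.1.1 i.1.2.2 U₀ b' : (Matrix (Fin 2) (Fin 2) ℂ)ˣ) : Matrix (Fin 2) (Fin 2) ℂ) * l₀ b'.tgt * (((bgUnits i.1.1 i.1.2.2 U₀ b')⁻¹ : (Matrix (Fin 2) (Fin 2) ℂ)ˣ) : Matrix (Fin 2) (Fin 2) ℂ)) ∧
        ∀ y : Site (i.1.1.P i.1.2.2) (i.1.2.2 - i.1.2.1), l₀ (embIter (i.1.2.2 - i.1.2.1) y) = cf y) →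
      ∀ a : ℝ, a₀ * (c₀ L / cB L) * ((i.1.1.L : ℝ) ^ (i.1.2.2 - i.1.2.1)) ^ 3 ≤ a →
      ∀ v : BondL2K ℂ 3 (periodsT3 i.1.1 i.1.2.2) (c₀ L) W₂,
        γco L * ‖v‖ ^ 2 ≤ RCLike.re ⟪v, laplaceA i.1.1 i.1.2.1 i.1.2.2 i.2.2.le (c₀ L) (cB L) a (DeltaEtaSlot i.1.1 i.1.2.1 i.1.2.2 (c₀ L)) U₀ v⟫_ℂ := by
  obtain ⟨αLOD, γLOD, hα, hWα, hγ, hT⟩ := hT_exists c₀ cB ha₀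
  refine ⟨fun L => min (αLOD L) (13 * 10 ^ 14 * (L : ℝ) ^ 3)⁻¹, γLOD, fun L hL => ?_, fun L hL => ?_, fun L hL => ?_, hγ, ?_⟩
  · have hL0 : (0 : ℝ) < L := by exact_mod_cast lt_trans zero_lt_one hL
    exact lt_min (hα L hL) (by positivity)
  · exact (mul_le_mul_of_nonneg_left (min_le_left _ _) (by positivity)).trans (hWα L hL)
  · have hL0 : (0 : ℝ) < L := by exact_mod_cast lt_trans zero_lt_one hL
    have hpos : (0 : ℝ) < 13 * 10 ^ 14 * (L : ℝ) ^ 3 := by positivity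
    calc 13 * 10 ^ 14 * (L : ℝ) ^ 3 * min (αLOD L) (13 * 10 ^ 14 * (L : ℝ) ^ 3)⁻¹
        ≤ 13 * 10 ^ 14 * (L : ℝ) ^ 3 * (13 * 10 ^ 14 * (L : ℝ) ^ 3)⁻¹ := mul_le_mul_of_nonneg_left (min_le_right _ _) hpos.le
      _ = 1 := mul_inv_cancel₀ hpos.ne'
  · intro L hL i U₀ ρ hreg hρ hlift a ha v
    have hρ' : ρ ≤ αLOD L := hρ.trans (min_le_left _ _)
    have hFL : (i.1.1.L : ℝ) = (L : ℝ) := by rw [i.2.1]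
    have hWε : 10 ^ 12 * (i.1.1.L : ℝ) ^ 3 * αLOD L ≤ 1 := by rw [hFL]; exact hWα L hL
    exact coercive_laplaceA_DeltaEtaSlot_of_curvedTarget_of_lift (F := i.1.1) (n := i.1.2.1) (K := i.1.2.2) (c₀ := c₀ L) i.2.2.le (cB L) (hα L hL) hWε U₀
      (regPr_mono (F := i.1.1) hρ' hreg) ha (hT L hL i U₀ (regPr_mono (F := i.1.1) hρ' hreg)) hlift v

/-- ★★★ **THE `L²` OPERATOR HALF OF THE EX ROW `norm_G` HOLDS, `∃`-PACKAGED** — same letters as `hco_DeltaEtaSlot_exists`: at every member `i` (so `n < K`), every `RegPr ρ U₀` with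
`ρ ≤ αco L`, ON THE LIFT LOCUS, and every coupling `a ≥ a₀·(c₀ L∕cB L)·(L^{K−n})³`: the class `PosOnto` holds at the slot `DeltaEtaSlot` and `‖GT … a (DeltaEtaSlot …) U₀ f‖ ≤ (γco L)⁻¹·‖f‖`
(print's Thm 3.3 `|G|` row (3.47) in the `L²` operator currency, K-uniform; the (115)-jet half of `norm_G` is the GRADIENT storey, not here).
[cite: Balaban1985BackgroundPropagators, Thm 3.3 (3.47) p.398, Thm 3.11 p.416, (3.27) p.395] -/
theorem normG_DeltaEtaSlot_exists (c₀ cB : ℕ → ℝ) [hc₀ : ∀ L : ℕ, Fact (0 < c₀ L)] [hcB : ∀ L : ℕ, Fact (0 < cB L)] {a₀ : ℝ} (ha₀ : 0 < a₀) :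
    ∃ (αco γco : ℕ → ℝ),
      (∀ L : ℕ, 1 < L → 0 < αco L) ∧ (∀ L : ℕ, 1 < L → 10 ^ 12 * (L : ℝ) ^ 3 * αco L ≤ 1) ∧ (∀ L : ℕ, 1 < L → 13 * 10 ^ 14 * (L : ℝ) ^ 3 * αco L ≤ 1) ∧
      (∀ L : ℕ, 1 < L → 0 < γco L) ∧
    ∀ (L : ℕ), 1 < L → ∀ (i : T3Thm1Carrier.Idx L) (U₀ : GaugeField (i.1.1.P i.1.2.2) 0 (Matrix.specialUnitaryGroup (Fin 2) ℂ)), ∀ ρ : ℝ, RegPr i.1.1 i.1.2.1 i.1.2.2 ρ U₀ → ρ ≤ αco L →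
        (∀ cf : Site (i.1.1.P i.1.2.2) (i.1.2.2 - i.1.2.1) → Matrix (Fin 2) (Fin 2) ℂ,
        (∀ e' : PBond (i.1.1.P i.1.2.2) (i.1.2.2 - i.1.2.1), cf e'.src = ((emlIterU (i.1.2.2 - i.1.2.1) (bgUnits i.1.1 i.1.2.2 U₀) e' : (Matrix (Fin 2) (Fin 2) ℂ)ˣ) : Matrix (Fin 2) (Fin 2) ℂ) * cf e'.tgt *
        (((emlIterU (i.1.2.2 - i.1.2.1) (bgUnits i.1.1 i.1.2.2 U₀) e')⁻¹ : (Matrix (Fin 2) (Fin 2) ℂ)ˣ) : Matrix (Fin 2) (Fin 2) ℂ)) →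
        ∃ l₀ : Site (i.1.1.P i.1.2.2) 0 → Matrix (Fin 2) (Fin 2) ℂ,
        (∀ b' : PBond (i.1.1.P i.1.2.2) 0, l₀ b'.src = ((bgUnits i.1.1 i.1.2.2 U₀ b' : (Matrix (Fin 2) (Fin 2) ℂ)ˣ) : Matrix (Fin 2) (Fin 2) ℂ) * l₀ b'.tgt * (((bgUnits i.1.1 i.1.2.2 U₀ b')⁻¹ : (Matrix (Fin 2) (Fin 2) ℂ)ˣ) : Matrix (Fin 2) (Fin 2) ℂ)) ∧
        ∀ y : Site (i.1.1.P i.1.2.2) (i.1.2.2 - i.1.2.1), l₀ (embIter (i.1.2.2 - i.1.2.1) y) = cf y) →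
      ∀ a : ℝ, a₀ * (c₀ L / cB L) * ((i.1.1.L : ℝ) ^ (i.1.2.2 - i.1.2.1)) ^ 3 ≤ a →
      PosOnto i.1.1 i.1.2.1 i.1.2.2 i.2.2.le (c₀ L) (cB L) a (DeltaEtaSlot i.1.1 i.1.2.1 i.1.2.2 (c₀ L)) U₀ ∧
      ∀ f : BondL2K ℂ 3 (periodsT3 i.1.1 i.1.2.2) (c₀ L) W₂,
        ‖GT i.1.1 i.1.2.1 i.1.2.2 i.2.2.le (c₀ L) (cB L) a (DeltaEtaSlot i.1.1 i.1.2.1 i.1.2.2 (c₀ L)) U₀ f‖ ≤ (γco L)⁻¹ * ‖f‖ := by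
  obtain ⟨αco, γco, hα, hW, hW', hγ, hco⟩ := hco_DeltaEtaSlot_exists c₀ cB ha₀
  refine ⟨αco, γco, hα, hW, hW', hγ, ?_⟩
  intro L hL i U₀ ρ hreg hρ hlift a ha
  have hFL : (i.1.1.L : ℝ) = (L : ℝ) := by rw [i.2.1]
  have hwin : 13 * 10 ^ 14 * (i.1.1.L : ℝ) ^ 3 * ρ ≤ 1 := by
    rw [hFL]
    have hpos : (0 : ℝ) ≤ 13 * 10 ^ 14 * (L : ℝ) ^ 3 := by positivity
    exact (mul_le_mul_of_nonneg_left hρ hpos).trans (hW' L hL)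
  have hco' := hco L hL i U₀ ρ hreg hρ hlift a ha
  exact ⟨posOnto_of_coercive (F := i.1.1) i.2.2.le (cB L) i.2.2 hreg hwin (hγ L hL) _ hco',
    fun f => norm_GT_le_of_coercive (F := i.1.1) i.2.2.le (cB L) i.2.2 hreg hwin (hγ L hL) _ hco' f⟩

/-! ## §5 The Π-slot `DeltaPiSlotP` (the slot of `norm_Hπ`, `h133`, `h88`, `h137kπ`): `hco` with `min γ ½ ∕ 2` through ★p1 g22's door -/

/-- ★★ **THE Π-SLOT AT THE MEMBER**: under `RegPr` + `10¹²L³ε₀ ≤ 1` + the curved target for every `Q″` of record + `Lift`, for `0 ≤ γ`, `0 ≤ a′`, `a ≤ a′`: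
`∀ x, (min γ ½ ∕ 2)·‖x‖² ≤ re⟪x, laplaceA … a′ (DeltaPiSlotP … a′) U₀ x⟫` — the target gives the slice row `hgf` (✓`gaugeFixedRow_of_curvedTarget`), and ★p1 g22's
✓`coercive_laplaceA_piSlot_of_gaugeFixed_of_lift` ((3.118) gauge decomposition + the gradient floor `½` on `N_S` under Lift) gives the Π-slot coercivity.
[cite: Balaban1985BackgroundPropagators, Thm 3.11 p.416, (3.118)–(3.122) pp.419–420] -/
theorem coercive_laplaceA_DeltaPiSlotP_of_curvedTarget_of_lift {ε₀ : ℝ} (hε₀ : 0 < ε₀) (hWε : 10 ^ 12 * (F.L : ℝ) ^ 3 * ε₀ ≤ 1)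
    (U₀ : GaugeField (F.P K) 0 (Matrix.specialUnitaryGroup (Fin 2) ℂ)) (hreg : RegPr F n K ε₀ U₀) {γ a a' : ℝ} (hγ : 0 ≤ γ) (ha' : 0 ≤ a') (haa : a ≤ a')
    (hT : ∀ (Q'' : SiteL2K ℂ 3 (periodsT3 F K) c₀ W₂ →ₗ[ℂ] (Site (F.P K) (K - n) → Matrix (Fin 2) (Fin 2) ℂ)),
      (∀ (lam : Site (F.P K) 0 → Matrix (Fin 2) (Fin 2) ℂ) (ns : (j : ℕ) → Site (F.P K) j → Matrix (Fin 2) (Fin 2) ℂ), ns 0 = lam →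
        (∀ (j : ℕ) (y : Site (F.P K) (j + 1)), ns (j + 1) y = ns j (emb y) - meanCLM (Idx (F.P K)) (Matrix (Fin 2) (Fin 2) ℂ) fun i : Idx (F.P K) =>
          ns j (emb y) - ((holT (emlIterU j (bgUnits F K U₀)) (emb y) (stairWord i.2.1 (off i.1)) : (Matrix (Fin 2) (Fin 2) ℂ)ˣ) : Matrix (Fin 2) (Fin 2) ℂ) *
            ns j (transl (emb y) (disp (stairWord i.2.1 (off i.1)))) * (((holT (emlIterU j (bgUnits F K U₀)) (emb y) (stairWord i.2.1 (off i.1)))⁻¹ : (Matrix (Fin 2) (Fin 2) ℂ)ˣ) : Matrix (Fin 2) (Fin 2) ℂ)) →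
        ns (K - n) = Q'' (toL2S F K c₀ lam)) →
      LinearMap.ker Q'' ≤ NS F n K h c₀ cB U₀ →
      ∀ A : BondL2K ℂ 3 (periodsT3 F K) c₀ W₂,
        γ * ‖A‖ ^ 2 ≤ RCLike.re ⟪A, DeltaEta F n K c₀ U₀ A⟫_ℂ
          + ‖projR (covLapSite F n K c₀ U₀) Q'' (DstarL2 F n K c₀ U₀ A)‖ ^ 2 + a * ‖Qk F n K h c₀ cB U₀ A‖ ^ 2)
    (hlift : ∀ cf : Site (F.P K) (K - n) → Matrix (Fin 2) (Fin 2) ℂ,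
        (∀ e : PBond (F.P K) (K - n), cf e.src = ((emlIterU (K - n) (bgUnits F K U₀) e : (Matrix (Fin 2) (Fin 2) ℂ)ˣ) : Matrix (Fin 2) (Fin 2) ℂ) * cf e.tgt *
          (((emlIterU (K - n) (bgUnits F K U₀) e)⁻¹ : (Matrix (Fin 2) (Fin 2) ℂ)ˣ) : Matrix (Fin 2) (Fin 2) ℂ)) →
        ∃ l₀ : Site (F.P K) 0 → Matrix (Fin 2) (Fin 2) ℂ,
          (∀ b : PBond (F.P K) 0, l₀ b.src = ((bgUnits F K U₀ b : (Matrix (Fin 2) (Fin 2) ℂ)ˣ) : Matrix (Fin 2) (Fin 2) ℂ) * l₀ b.tgt * (((bgUnits F K U₀ b)⁻¹ : (Matrix (Fin 2) (Fin 2) ℂ)ˣ) : Matrix (Fin 2) (Fin 2) ℂ)) ∧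
          ∀ y : Site (F.P K) (K - n), l₀ (embIter (K - n) y) = cf y) :
    ∀ x : BondL2K ℂ 3 (periodsT3 F K) c₀ W₂,
      min γ (1 / 2) / 2 * ‖x‖ ^ 2 ≤ RCLike.re ⟪x, laplaceA F n K h c₀ cB a' (DeltaPiSlotP F n K h c₀ cB a') U₀ x⟫_ℂ := by
  have hgf : ∀ A : BondL2K ℂ 3 (periodsT3 F K) c₀ W₂, RS F n K h c₀ cB U₀ (DstarL2 F n K c₀ U₀ A) = 0 →
      γ * ‖A‖ ^ 2 ≤ RCLike.re ⟪A, DeltaEta F n K c₀ U₀ A⟫_ℂ + a' * ‖Qk F n K h c₀ cB U₀ A‖ ^ 2 := by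
    intro A hA
    have h1 := gaugeFixedRow_of_curvedTarget (F := F) h cB hε₀ hWε U₀ hreg hT hlift A hA
    have h2 : a * ‖Qk F n K h c₀ cB U₀ A‖ ^ 2 ≤ a' * ‖Qk F n K h c₀ cB U₀ A‖ ^ 2 := mul_le_mul_of_nonneg_right haa (sq_nonneg _)
    linarith
  exact coercive_laplaceA_piSlot_of_gaugeFixed_of_lift F h hε₀ hWε ha' U₀ hreg hlift hγ hgf

/-- ★★★ **THE Π-SLOT (γ) LETTER `∃`-PACKAGED** — same road as `hco_DeltaEtaSlot_exists`: letter families `αco γco : ℕ → ℝ` with the three windows and `0 < γco L`, and for every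
member, every `RegPr ρ U₀` with `ρ ≤ αco L`, ON THE LIFT LOCUS, every coupling `a ≥ a₀·(c₀ L∕cB L)·(L^{K−n})³`: `∀ x, γco L·‖x‖² ≤ re⟪x, laplaceA … a (DeltaPiSlotP … a) U₀ x⟫`
(`γco := min γLOD ½ ∕ 2`) — the positivity input of the `H1f`∕`KinvT` letters at the Π-slot (EX rows `norm_Hπ`, `h133`, `h88`, `h137kπ`).
[cite: Balaban1985BackgroundPropagators, Thm 3.11 p.416, (3.118)–(3.122) pp.419–420, (3.126) p.420] -/
theorem hco_DeltaPiSlotP_exists (c₀ cB : ℕ → ℝ) [hc₀ : ∀ L : ℕ, Fact (0 < c₀ L)] [hcB : ∀ L : ℕ, Fact (0 < cB L)] {a₀ : ℝ} (ha₀ : 0 < a₀) :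
    ∃ (αco γco : ℕ → ℝ),
      (∀ L : ℕ, 1 < L → 0 < αco L) ∧ (∀ L : ℕ, 1 < L → 10 ^ 12 * (L : ℝ) ^ 3 * αco L ≤ 1) ∧ (∀ L : ℕ, 1 < L → 13 * 10 ^ 14 * (L : ℝ) ^ 3 * αco L ≤ 1) ∧
      (∀ L : ℕ, 1 < L → 0 < γco L) ∧
    ∀ (L : ℕ), 1 < L → ∀ (i : T3Thm1Carrier.Idx L) (U₀ : GaugeField (i.1.1.P i.1.2.2) 0 (Matrix.specialUnitaryGroup (Fin 2) ℂ)), ∀ ρ : ℝ, RegPr i.1.1 i.1.2.1 i.1.2.2 ρ U₀ → ρ ≤ αco L →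
        (∀ cf : Site (i.1.1.P i.1.2.2) (i.1.2.2 - i.1.2.1) → Matrix (Fin 2) (Fin 2) ℂ,
        (∀ e' : PBond (i.1.1.P i.1.2.2) (i.1.2.2 - i.1.2.1), cf e'.src = ((emlIterU (i.1.2.2 - i.1.2.1) (bgUnits i.1.1 i.1.2.2 U₀) e' : (Matrix (Fin 2) (Fin 2) ℂ)ˣ) : Matrix (Fin 2) (Fin 2) ℂ) * cf e'.tgt *
        (((emlIterU (i.1.2.2 - i.1.2.1) (bgUnits i.1.1 i.1.2.2 U₀) e')⁻¹ : (Matrix (Fin 2) (Fin 2) ℂ)ˣ) : Matrix (Fin 2) (Fin 2) ℂ)) →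
        ∃ l₀ : Site (i.1.1.P i.1.2.2) 0 → Matrix (Fin 2) (Fin 2) ℂ,
        (∀ b' : PBond (i.1.1.P i.1.2.2) 0, l₀ b'.src = ((bgUnits i.1.1 i.1.2.2 U₀ b' : (Matrix (Fin 2) (Fin 2) ℂ)ˣ) : Matrix (Fin 2) (Fin 2) ℂ) * l₀ b'.tgt * (((bgUnits i.1.1 i.1.2.2 U₀ b')⁻¹ : (Matrix (Fin 2) (Fin 2) ℂ)ˣ) : Matrix (Fin 2) (Fin 2) ℂ)) ∧
        ∀ y : Site (i.1.1.P i.1.2.2) (i.1.2.2 - i.1.2.1), l₀ (embIter (i.1.2.2 - i.1.2.1) y) = cf y) →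
      ∀ a : ℝ, a₀ * (c₀ L / cB L) * ((i.1.1.L : ℝ) ^ (i.1.2.2 - i.1.2.1)) ^ 3 ≤ a →
      ∀ x : BondL2K ℂ 3 (periodsT3 i.1.1 i.1.2.2) (c₀ L) W₂,
        γco L * ‖x‖ ^ 2 ≤ RCLike.re ⟪x, laplaceA i.1.1 i.1.2.1 i.1.2.2 i.2.2.le (c₀ L) (cB L) a (DeltaPiSlotP i.1.1 i.1.2.1 i.1.2.2 i.2.2.le (c₀ L) (cB L) a) U₀ x⟫_ℂ := by
  obtain ⟨αLOD, γLOD, hα, hWα, hγ, hT⟩ := hT_exists c₀ cB ha₀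
  refine ⟨fun L => min (αLOD L) (13 * 10 ^ 14 * (L : ℝ) ^ 3)⁻¹, fun L => min (γLOD L) (1 / 2) / 2, fun L hL => ?_, fun L hL => ?_, fun L hL => ?_,
    fun L hL => by have := hγ L hL; positivity, ?_⟩
  · have hL0 : (0 : ℝ) < L := by exact_mod_cast lt_trans zero_lt_one hL
    exact lt_min (hα L hL) (by positivity)
  · exact (mul_le_mul_of_nonneg_left (min_le_left _ _) (by positivity)).trans (hWα L hL)
  · have hL0 : (0 : ℝ) < L := by exact_mod_cast lt_trans zero_lt_one hL
    have hpos : (0 : ℝ) < 13 * 10 ^ 14 * (L : ℝ) ^ 3 := by positivity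
    calc 13 * 10 ^ 14 * (L : ℝ) ^ 3 * min (αLOD L) (13 * 10 ^ 14 * (L : ℝ) ^ 3)⁻¹
        ≤ 13 * 10 ^ 14 * (L : ℝ) ^ 3 * (13 * 10 ^ 14 * (L : ℝ) ^ 3)⁻¹ := mul_le_mul_of_nonneg_left (min_le_right _ _) hpos.le
      _ = 1 := mul_inv_cancel₀ hpos.ne'
  · intro L hL i U₀ ρ hreg hρ hlift a ha x
    have hρ' : ρ ≤ αLOD L := hρ.trans (min_le_left _ _)
    have hFL : (i.1.1.L : ℝ) = (L : ℝ) := by rw [i.2.1]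
    have hWε : 10 ^ 12 * (i.1.1.L : ℝ) ^ 3 * αLOD L ≤ 1 := by rw [hFL]; exact hWα L hL
    have ha0 : (0 : ℝ) ≤ a :=
      (mul_nonneg (mul_nonneg ha₀.le (div_nonneg (hc₀ L).out.le (hcB L).out.le)) (pow_nonneg (pow_nonneg (Nat.cast_nonneg _) _) _)).trans ha
    exact coercive_laplaceA_DeltaPiSlotP_of_curvedTarget_of_lift (F := i.1.1) (n := i.1.2.1) (K := i.1.2.2) (c₀ := c₀ L) i.2.2.le (cB L) (hα L hL) hWε U₀
      (regPr_mono (F := i.1.1) hρ' hreg) (hγ L hL).le ha0 ha (hT L hL i U₀ (regPr_mono (F := i.1.1) hρ' hreg)) hlift x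

end Summit.QuantumFields.YangMills.Theorems.Prop7OneFormCoerciveHolds

end
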